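import Summits.ABC.IUTFork.DAGL2q

/-!
# Kernel DAG index — witness UPGRADE part p (GENERATED by abc-iut-c312-2 gen 6 `work/gen_index.py upgrade` @2026-08-26T21:12Z from HOME/plan/DAG.tsv
(regenerated 2026-08-26T20:24:57Z); spec v1.3 §2(c) "`_holds` iff the DAG row is discharged", §5 "re-file when nodes change status")

THIS FILE PROVES NOTHING NEW AND ASSERTS NOTHING. For 1 nodes ALREADY INDEXED with a partial witness `N_<id>_part` (their DAG row was
`landed(p…)` when indexed) whose row is NOW `discharged(p…)`, it adds the discharge witness `N_<id>_holds : N_<id> := N_<id>_part` BY NAME —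
the node statement `N_<id>` is untouched (append-only across files: nothing landed is redefined). Nothing here says abc is proved or refuted
or takes a side on [IUTchIII] Cor 3.12. typed ≠ discharged; indexed ≠ endorsed.
-/

namespace Summit.ABC.IUTFork.DAG

/-- [node EtTh:Cor2.16 · L2/D1 · DAG status discharged(p453594)] discharge witness of `N_EtTh_Cor2_16` (indexed in `DAGL2q` with `_part` while the row was landed; now discharged, p453594): BY NAME; proves nothing new. -/
theorem N_EtTh_Cor2_16_holds : N_EtTh_Cor2_16 := N_EtTh_Cor2_16_part

end Summit.ABC.IUTFork.DAG
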